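import Summits.CriticalPhenomena.CardyFormulaZ2.Theorems.CardyFlipRussoCoveringLegStubBlockingPrelim
import Summits.CriticalPhenomena.CardyFormulaZ2.Theorems.CardyFlipRussoCoveringLegStubBlockingChart
import Literature.Topology.PlaneTopology.StripCrossings
import HarnessLib

/-!
# Stub `stub_blocking_of_planar` of line `five-arm-null` (skeleton v5), crux `CardyFlipRusso.CoveringLeg`

Helper file `--supports stmt-CriticalPhenomena-6435` proving the registered stub
`stub_blocking_of_planar : Sig.stub_blockingOfPlanar` (= `Sig.stub_gsPlanar → Sig.stub_blocking`) of
`CardyFlipRussoCoveringLegRobustDefs.lean`: the exact-duality half of the Bollobás–Riordan collar sandwich for the CRUDE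
crossing events of critical site percolation on Beffara's centred square lattice `G_s` (frame B, drawing `zS`).

THE STATEMENT.  `R = (Ω; arcs 0–3)` is a conformal rectangle and `m > 0` a lateral margin.  There is a plate margin `t > 0`
such that for every upper comparison quad `N` with room `r` in sandwich position (points of the `r`-fattening of `N` off `Ω`
are `t`-close to `arc 1 ∪ arc 3`, all of it is `m`-far from `arc 0 ∪ arc 2`, the fattened end arcs `N.arc 0`, `N.arc 2` lie
off `Ω`, `t`-close to `arc 1`, resp. `arc 3`), for all small meshes `δ` and translations `‖a‖ ≤ δ`: a configuration whose
complement has a crude crossing of `N + a` (a CLOSED `G_s`-path in `N + a` from `2δ`-near `N.arc 0 + a` to `2δ`-near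
`N.arc 2 + a`) has no open wide-slack crude crossing of `R` (an OPEN `G_s`-path in `Ω` from `2√2δ`-near `arc 0` to
`2√2δ`-near `arc 2`).

THE PROOF (Bollobás–Riordan 2006, Ch. 7, Claim 19 second part, p. 192).  Draw both paths as polylines through the positions
`δ·zS`.  They are disjoint: one consists of closed, the other of open sites, and the straight-line drawing of `G_s` is planar
(`block_traces_disjoint`, from `Sig.stub_gsPlanar`).  Pull both back by a square model `Φ` of `R` (`exists_isSquareModel`:
a plane homeomorphism with `Φ((-1,1)²) = Ω`, side `k ↦ arc k`).  With `η` a uniform-continuity modulus of `Φ` on the box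
`[-2,2]²` for `m` and `ν = η/4`, choose `t = θ/2` where `θ` is a modulus of `Φ⁻¹` near `closure Ω` for `ν`.  Then
(`block_closed_point`) every point of the closed polyline pulls back into the horizontal band `|im| ≤ 1 − 2ν` (in `Ω`: it is
`m`-far from arcs 0, 2, so `η`-far from the bottom and top sides; off `Ω`: it is moreover `t`-close to `arc 1` or `arc 3`, so
`ν`-close to a lateral side), its first point — a point of the cap beyond `arc 1`, a whole `r/2`-ball around which misses
`Ω` — pulls back to `re ≥ 1 + η_r/2` (`block_re_ge_of_cap`, `η_r` a modulus of `Φ` for `r/2`) and its last point to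
`re ≤ −1 − η_r/2`.  For `δ` small (a modulus of `Φ⁻¹` for `η_r/4`) every point of the open polyline, being within `δ` of a
site in `Ω`, pulls back into the vertical strip `|re| ≤ 1 + η_r/4`, its first point (`3δ`-close to `arc 0`) below the band
and its last point above it.  A sub-continuum of the pulled-back closed polyline crosses the rectangle
`[−1 − η_r/4, 1 + η_r/4] × [−(1 − 2ν), 1 − 2ν]` from left to right (`exists_subcontinuum_between_lines`), a sub-path of the
pulled-back open polyline crosses it from bottom to top (`exists_subpath_crossing_levels`), so they meet
(`exists_mem_of_isPreconnected_crossing`) — contradicting disjointness.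

References: B. Bollobás, O. Riordan, *Percolation*, CUP (2006), Ch. 7 Claim 19 p. 192 [BollobasRiordan2006];
V. Beffara, *Is critical 2D percolation universal?*, Progr. Probab. 60 (2008) §5.1 [Beffara2008Universal];
O. Schramm, S. Smirnov, Ann. Probab. 39 (2011), proof of Lemma 5.1 (square models) [SchrammSmirnov2011].
-/

noncomputable section

namespace Summit.CriticalPhenomena.CardyFormulaZ2.Cruxes.CoveringLeg.FiveArmNull

open Set Metric
open Literature.Probability.RandomPlanarGeometry Literature.Probability.Percolation
open Literature.Topology.PlaneTopology
open Literature.Barriers.CriticalPhenomena (MixedSite)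

/-! ### The two crossings as chains of sites -/

/-- **A crude crossing is a chain**: `ω ∈ crossS R' δ` yields a chain `f : Fin (n+1) → MixedSite` of `G_s`-adjacent sites of
`ω`, drawn in `R'`, from `2δ`-near `R'.arc 0` to `2δ`-near `R'.arc 2`. [cite: Beffara2008Universal, §5.2] -/
theorem block_chain_of_crossS {R' : ConformalRectangle} {δ : ℝ} {ω : Set MixedSite} (h : ω ∈ crossS R' δ) :
    ∃ (n : ℕ) (f : Fin (n + 1) → MixedSite),
      infDist ((δ : ℂ) * zS (f 0)) (R'.arc 0) ≤ 2 * δ ∧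
      infDist ((δ : ℂ) * zS (f (Fin.last n))) (R'.arc 2) ≤ 2 * δ ∧
      (∀ i, (δ : ℂ) * zS (f i) ∈ R'.carrier ∧ f i ∈ ω) ∧
      ∀ i : Fin n, gsGraph.Adj (f (Fin.castSucc i)) (f (Fin.succ i)) := by
  obtain ⟨u, v, hu, hv, hω⟩ := h
  obtain ⟨n, f, hf0, hfn, hfA, hadj⟩ := block_pathIn_chain (mem_siteConnIn_iff_pathIn.1 hω)
  refine ⟨n, f, ?_, ?_, fun i => hfA i, hadj⟩
  · rw [hf0]; exact hu
  · rw [hfn]; exact hv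

/-- **A wide crude crossing is a chain**: `ω ∈ wideS R δ` yields a chain of `G_s`-adjacent sites of `ω`, drawn in `Ω`, from
`2√2δ`-near `arc 0` to `2√2δ`-near `arc 2`. [cite: Beffara2008Universal, §5.1] -/
theorem block_chain_of_wideS {R : ConformalRectangle} {δ : ℝ} {ω : Set MixedSite} (h : ω ∈ wideS R δ) :
    ∃ (n : ℕ) (f : Fin (n + 1) → MixedSite),
      infDist ((δ : ℂ) * zS (f 0)) (R.arc 0) ≤ 2 * Real.sqrt 2 * δ ∧
      infDist ((δ : ℂ) * zS (f (Fin.last n))) (R.arc 2) ≤ 2 * Real.sqrt 2 * δ ∧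
      (∀ i, (δ : ℂ) * zS (f i) ∈ R.carrier ∧ f i ∈ ω) ∧
      ∀ i : Fin n, gsGraph.Adj (f (Fin.castSucc i)) (f (Fin.succ i)) := by
  obtain ⟨u, v, hu, hv, hω⟩ := h
  obtain ⟨n, f, hf0, hfn, hfA, hadj⟩ := block_pathIn_chain (mem_siteConnIn_iff_pathIn.1 hω)
  refine ⟨n, f, ?_, ?_, fun i => hfA i, hadj⟩
  · rw [hf0]; exact hu
  · rw [hfn]; exact hv

/-- The polyline of a chain starts at the first drawn position. [folklore] -/
theorem block_polyline_zero {n : ℕ} (F : Fin (n + 1) → ℂ) : affineInterp (List.ofFn F) 0 = F 0 := by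
  have h := affineInterp_natCast (List.ofFn F) 0 (by simp)
  rw [Nat.cast_zero, List.getElem_ofFn] at h
  exact h

/-- The polyline of a chain ends at the last drawn position. [folklore] -/
theorem block_polyline_last {n : ℕ} (F : Fin (n + 1) → ℂ) : affineInterp (List.ofFn F) n = F (Fin.last n) := by
  have h := affineInterp_natCast (List.ofFn F) n (by simp)
  rw [List.getElem_ofFn] at h
  exact h

/-- A point `2δ`-close to the translated arc `Q.arc i + a`, `‖a‖ ≤ δ`, is within `3δ` of a point of `Q.arc i`. [folklore] -/
theorem block_exists_arc_dist_le (Q : ConformalRectangle) (i : Fin 4) {a p : ℂ} {δ : ℝ} (ha : ‖a‖ ≤ δ)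
    (h : infDist p ((Q.map (similarity 1 one_ne_zero a)).arc i) ≤ 2 * δ) : ∃ z ∈ Q.arc i, dist p z ≤ 3 * δ := by
  obtain ⟨q, hq, hpq⟩ := ((Q.map (similarity 1 one_ne_zero a)).isCompact_arc i).exists_infDist_eq_dist
    ⟨_, (Q.map (similarity 1 one_ne_zero a)).pt_mem_arc_self i⟩ p
  rw [hpq] at h
  rw [MarkedDomain.arc_map] at hq
  obtain ⟨z, hz, rfl⟩ := hq
  rw [similarity_apply, one_mul] at h
  refine ⟨z, hz, ?_⟩
  calc dist p z ≤ dist p (z + a) + dist (z + a) z := dist_triangle _ _ _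
    _ ≤ 2 * δ + δ := by
        gcongr
        rw [dist_eq_norm, add_sub_cancel_left]
        exact ha
    _ = 3 * δ := by ring

/-- A drawn site of the translated quad `Q + a`, `‖a‖ ≤ δ`, is within `δ` of a point of `Q`. [folklore] -/
theorem block_exists_carrier_dist_le (Q : ConformalRectangle) {a p : ℂ} {δ : ℝ} (ha : ‖a‖ ≤ δ)
    (h : p ∈ (Q.map (similarity 1 one_ne_zero a)).carrier) : ∃ z ∈ Q.carrier, dist p z ≤ δ := by
  rw [MarkedDomain.carrier_map] at h
  obtain ⟨z, hz, rfl⟩ := h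
  refine ⟨z, hz, ?_⟩
  rw [similarity_apply, one_mul, dist_eq_norm, add_sub_cancel_left]
  exact ha

/-! ### The topological heart: a left–right continuum meets a bottom–top path -/

/-- **Crossing in the model.**  Let `γ₁, γ₂ : ℝ → ℂ` be continuous.  Suppose that on `[0, n₁]` the curve `γ₁` stays in the
horizontal band `|im| ≤ h` (`h > 0`), starts at `re ≥ B` and ends at `re ≤ −B` (`B ≥ 0`), and that on `[0, n₂]` the curve
`γ₂` stays in the vertical strip `|re| ≤ B`, starts at `im ≤ −h` and ends at `im ≥ h`.  Then `γ₁ [0, n₁]` meets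
`γ₂ [0, n₂]`: a sub-continuum of `γ₁ [0, n₁]` crosses the rectangle `[−B, B] × [−h, h]` between its vertical sides
(`exists_subcontinuum_between_lines`), a sub-path of `γ₂` crosses it from bottom to top inside the band
(`exists_subpath_crossing_levels`), and the crossing lemma `exists_mem_of_isPreconnected_crossing` applies.
[cite: BollobasRiordan2006, Ch. 7 Claim 19 p. 192] -/
theorem block_model_crossing {γ₁ γ₂ : ℝ → ℂ} (h₁ : Continuous γ₁) (h₂ : Continuous γ₂) {n₁ n₂ B h : ℝ}
    (hn₁ : 0 ≤ n₁) (hn₂ : 0 ≤ n₂) (hB : 0 ≤ B) (hh : 0 < h)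
    (hband : ∀ s ∈ Icc 0 n₁, |(γ₁ s).im| ≤ h) (hstart : B ≤ (γ₁ 0).re) (hend : (γ₁ n₁).re ≤ -B)
    (hstrip : ∀ s ∈ Icc 0 n₂, |(γ₂ s).re| ≤ B) (hbot : (γ₂ 0).im ≤ -h) (htop : h ≤ (γ₂ n₂).im) :
    ∃ s ∈ Icc 0 n₁, ∃ s' ∈ Icc 0 n₂, γ₁ s = γ₂ s' := by
  -- the continuum: a sub-continuum of `γ₁ [0, n₁]` inside the strip `|re| ≤ B`, meeting both vertical lines
  set K : Set ℂ := γ₁ '' Icc 0 n₁ with hK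
  have hKc : IsCompact K := isCompact_Icc.image h₁
  have hKpc : IsPreconnected K := isPreconnected_Icc.image _ h₁.continuousOn
  have h0mem : (0 : ℝ) ∈ Icc 0 n₁ := ⟨le_rfl, hn₁⟩
  have hn₁mem : n₁ ∈ Icc 0 n₁ := ⟨hn₁, le_rfl⟩
  obtain ⟨K', hK'K, hK'c, hK'pc, hK'strip, hK'a, hK'b⟩ :=
    exists_subcontinuum_between_lines (K := K) (a := -B) (b := B) (by linarith) hKc hKpc
      ⟨γ₁ n₁, mem_image_of_mem _ hn₁mem, hend⟩ ⟨γ₁ 0, mem_image_of_mem _ h0mem, hstart⟩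
  have hK'sub : K' ⊆ Icc (-B) B ×ℂ Icc (-h) h := by
    intro z hz
    obtain ⟨s, hs, rfl⟩ := hK'K hz
    have hb := abs_le.1 (hband s hs)
    rw [Complex.mem_reProdIm, mem_Icc, mem_Icc]
    exact ⟨hK'strip _ hz, hb⟩
  -- the path: `γ₂` run backwards (from the top to the bottom), clamped to `[0, 1]`
  set g : ℝ → ℂ := fun τ => γ₂ (n₂ * (1 - (projIcc (0 : ℝ) 1 zero_le_one τ : ℝ))) with hg
  have hgc : Continuous g :=
    h₂.comp (continuous_const.mul (continuous_const.sub (continuous_subtype_val.comp continuous_projIcc)))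
  have hgmem : ∀ τ, n₂ * (1 - (projIcc (0 : ℝ) 1 zero_le_one τ : ℝ)) ∈ Icc 0 n₂ := fun τ => by
    have hp := (projIcc (0 : ℝ) 1 zero_le_one τ).2
    rw [mem_Icc] at hp ⊢
    constructor <;> nlinarith [hp.1, hp.2]
  have hgτ : ∀ τ ∈ Icc (0 : ℝ) 1, g τ = γ₂ (n₂ * (1 - τ)) := fun τ hτ => by
    simp only [hg, projIcc_of_mem zero_le_one hτ]
  have hg0 : h ≤ (g 0).im := by
    rw [hgτ 0 ⟨le_rfl, zero_le_one⟩, sub_zero, mul_one]; exact htop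
  have hg1 : (g 1).im ≤ -h := by
    rw [hgτ 1 ⟨zero_le_one, le_rfl⟩, sub_self, mul_zero]; exact hbot
  obtain ⟨t₁, t₂, -, ht₁₂, -, hgt₁, hgt₂, hband'⟩ :=
    exists_subpath_crossing_levels hgc (by linarith : -h < h) hg0 hg1
  -- reparametrised from the bottom (`t₂`) to the top (`t₁`)
  set β : ℝ → ℂ := fun u => g (t₂ + (t₁ - t₂) * u) with hβ
  have hmemI : ∀ u ∈ Icc (0 : ℝ) 1, t₁ ≤ t₂ + (t₁ - t₂) * u ∧ t₂ + (t₁ - t₂) * u ≤ t₂ := by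
    intro u hu
    rw [mem_Icc] at hu
    constructor <;> nlinarith [hu.1, hu.2, ht₁₂]
  have hβc : Continuous β := hgc.comp (by fun_prop)
  have hβmaps : MapsTo β (Icc 0 1) (Icc (-B) B ×ℂ Icc (-h) h) := fun u hu => by
    obtain ⟨i1, i2⟩ := hband' _ (hmemI u hu).1 (hmemI u hu).2
    have hre := abs_le.1 (hstrip _ (hgmem (t₂ + (t₁ - t₂) * u)))
    rw [Complex.mem_reProdIm, mem_Icc, mem_Icc]
    exact ⟨hre, i1, i2⟩
  have hβ0 : (β 0).im = -h := by
    show (g (t₂ + (t₁ - t₂) * 0)).im = -h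
    rw [mul_zero, add_zero, hgt₂]
  have hβ1 : (β 1).im = h := by
    show (g (t₂ + (t₁ - t₂) * 1)).im = h
    rw [mul_one, add_sub_cancel, hgt₁]
  obtain ⟨u, -, huK⟩ := exists_mem_of_isPreconnected_crossing (by linarith : -B ≤ B) (by linarith : -h ≤ h)
    hK'c hK'pc hK'sub hK'a hK'b hβc.continuousOn hβmaps hβ0 hβ1
  obtain ⟨s, hs, hsu⟩ := hK'K huK
  exact ⟨s, hs, n₂ * (1 - (projIcc (0 : ℝ) 1 zero_le_one (t₂ + (t₁ - t₂) * u) : ℝ)), hgmem _, hsu.trans rfl⟩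

/-! ### Points of the closed polyline pull back into the horizontal band -/

/-- **A point of the closed crossing pulls back into the band.**  Let `Φ` be a square model of `R`, let `Φ` move `4ν`-close
points of the box `m`-close (`0 < ν ≤ 1/4`), let `Φ⁻¹` move `θ`-close pairs (second point in `closure Ω`) `ν`-close, and
`t < θ`.  If `x` is `m`-far from `arc 0` and `arc 2`, and `t`-close to `arc 1` or `arc 3` unless `x ∈ Ω`, then
`|im (Φ⁻¹ x)| ≤ 1 − 2ν` and `Φ⁻¹ x` lies in the box `[-2, 2]²`. [cite: BollobasRiordan2006, Ch. 7 p. 186 (Fig. 14)] -/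
theorem block_closed_point {R : ConformalRectangle} {Φ : ℂ ≃ₜ ℂ} (hΦ : IsSquareModel R Φ) {m ν θ t : ℝ}
    (hν : 0 < ν) (hν4 : ν ≤ 1 / 4)
    (hucm : ∀ z ∈ Icc (-2 : ℝ) 2 ×ℂ Icc (-2 : ℝ) 2, ∀ z' ∈ Icc (-2 : ℝ) 2 ×ℂ Icc (-2 : ℝ) 2,
      dist z z' < 4 * ν → dist (Φ z) (Φ z') < m)
    (hθuc : ∀ x y : ℂ, y ∈ closure R.carrier → dist x y < θ → dist (Φ.symm x) (Φ.symm y) < ν)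
    (htθ : t < θ) {x : ℂ}
    (h3 : x ∉ R.carrier → infDist x (R.arc 1) ≤ t ∨ infDist x (R.arc 3) ≤ t)
    (h4 : m ≤ infDist x (R.arc 0) ∧ m ≤ infDist x (R.arc 2)) :
    |(Φ.symm x).im| ≤ 1 - 2 * ν ∧ Φ.symm x ∈ Icc (-2 : ℝ) 2 ×ℂ Icc (-2 : ℝ) 2 := by
  by_cases hx : x ∈ R.carrier
  · obtain ⟨hre, him⟩ : (Φ.symm x).re ∈ Ioo (-1 : ℝ) 1 ∧ (Φ.symm x).im ∈ Ioo (-1 : ℝ) 1 := by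
      rw [← hΦ.image_carrier] at hx
      obtain ⟨z, hz, rfl⟩ := hx
      rw [Homeomorph.symm_apply_apply]
      rwa [unitSquareQuad_carrier, Complex.mem_reProdIm] at hz
    have hbox : Φ.symm x ∈ Icc (-2 : ℝ) 2 ×ℂ Icc (-2 : ℝ) 2 :=
      Complex.mem_reProdIm.2 ⟨⟨by linarith [hre.1], by linarith [hre.2]⟩, by linarith [him.1], by linarith [him.2]⟩
    have hb := block_band_of_square hν.le hre him (block_far_side hΦ hucm 0 hbox h4.1)
      (block_far_side hΦ hucm 2 hbox h4.2)
    exact ⟨abs_le.2 ⟨hb.1, hb.2⟩, hbox⟩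
  · -- off `Ω`: within `ν` of side 1 or side 3
    have hnear : ∃ z, (z ∈ unitSquareQuad.arc 1 ∨ z ∈ unitSquareQuad.arc 3) ∧ dist (Φ.symm x) z < ν := by
      rcases h3 hx with h | h
      · obtain ⟨z, hz, hd⟩ := block_near_side hΦ hθuc 1 h htθ
        exact ⟨z, Or.inl hz, hd⟩
      · obtain ⟨z, hz, hd⟩ := block_near_side hΦ hθuc 3 h htθ
        exact ⟨z, Or.inr hz, hd⟩
    obtain ⟨z, hz, hd⟩ := hnear
    have hzc : z.re ∈ Icc (-1 : ℝ) 1 ∧ z.im ∈ Icc (-1 : ℝ) 1 := by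
      rcases hz with hz | hz <;> exact block_side_coord hz
    obtain ⟨e1, e2, e3, e4⟩ := block_re_im_of_dist hd.le
    have hbox : Φ.symm x ∈ Icc (-2 : ℝ) 2 ×ℂ Icc (-2 : ℝ) 2 :=
      Complex.mem_reProdIm.2 ⟨⟨by linarith [hzc.1.1], by linarith [hzc.1.2]⟩, by linarith [hzc.2.1],
        by linarith [hzc.2.2]⟩
    obtain ⟨hb, -⟩ := block_band_of_near_side hν hν4 hz hd.le (block_far_side hΦ hucm 0 hbox h4.1)
      (block_far_side hΦ hucm 2 hbox h4.2)
    exact ⟨abs_le.2 ⟨hb.1, hb.2⟩, hbox⟩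

/-! ### The stub -/

/-- **Registered stub `stub_blocking_of_planar` of skeleton v5** (`Sig.stub_blockingOfPlanar`, i.e.
`Sig.stub_gsPlanar → Sig.stub_blocking`): given the planarity of the straight-line drawing of `G_s`, a CLOSED crude crossing
of the shifted upper quad `N + a` excludes every OPEN wide-slack crude crossing of `R`, for all small meshes — the exact
duality half of the Bollobás–Riordan collar sandwich (see the module docstring for the proof).
[cite: BollobasRiordan2006, Ch. 7 Claim 19 (second part) p. 192] -/
theorem stub_blocking_of_planar :
    Summit.CriticalPhenomena.CardyFormulaZ2.Cruxes.CoveringLeg.FiveArmNull.Sig.stub_blockingOfPlanar := by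
  intro hP R m hm
  -- a square model of `R` and the lateral modulus `η = 4ν` of `Φ` for the margin `m`
  obtain ⟨Φ, hΦ⟩ := exists_isSquareModel R
  obtain ⟨η, hη, hη1, hucη⟩ := block_uc Φ hm
  set ν : ℝ := η / 4 with hν
  have hν0 : 0 < ν := by positivity
  have hν4 : ν ≤ 1 / 4 := by rw [hν]; linarith
  have hucm : ∀ z ∈ Icc (-2 : ℝ) 2 ×ℂ Icc (-2 : ℝ) 2, ∀ z' ∈ Icc (-2 : ℝ) 2 ×ℂ Icc (-2 : ℝ) 2,
      dist z z' < 4 * ν → dist (Φ z) (Φ z') < m := fun z hz z' hz' hd =>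
    hucη z hz z' hz' (by rw [hν] at hd; linarith)
  -- the plate margin `t = θ/2`, `θ` a modulus of `Φ⁻¹` near `closure Ω` for `ν`
  obtain ⟨θ, hθ, -, hθuc⟩ := block_symm_uc hΦ hν0
  have htθ : θ / 2 < θ := half_lt_self hθ
  refine ⟨θ / 2, half_pos hθ, ?_⟩
  intro N r hr n3 n4 n5 n6
  -- the cap modulus `η_r` of `Φ` for `r/2`, and a modulus `θ_r` of `Φ⁻¹` for `η_r/4`
  obtain ⟨ηr, hηr, hηr1, hucr⟩ := block_uc Φ (half_pos hr)
  obtain ⟨θr, hθr, -, hθruc⟩ := block_symm_uc hΦ (by positivity : (0 : ℝ) < ηr / 4)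
  refine ⟨min (r / 6) (min (θ / 6) (θr / 2)), by positivity, ?_⟩
  intro δ hδ hδle a ha ω hcl hop
  have hδr : δ ≤ r / 6 := hδle.trans (min_le_left _ _)
  have hδθ : δ ≤ θ / 6 := hδle.trans ((min_le_right _ _).trans (min_le_left _ _))
  have hδθr : δ ≤ θr / 2 := hδle.trans ((min_le_right _ _).trans (min_le_right _ _))
  -- the two crossings as chains: `f` closed in `N + a`, `g` open in `Ω`
  obtain ⟨n, f, hf0, hfn, hfN, hfadj⟩ := block_chain_of_crossS hcl
  obtain ⟨n', g, hg0, hgn, hgR, hgadj⟩ := block_chain_of_wideS hop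
  set C : ℝ → ℂ := affineInterp (List.ofFn fun i => (δ : ℂ) * zS (f i)) with hC
  set O : ℝ → ℂ := affineInterp (List.ofFn fun i => (δ : ℂ) * zS (g i)) with hO
  have hC0 : C 0 = (δ : ℂ) * zS (f 0) := block_polyline_zero _
  have hCn : C n = (δ : ℂ) * zS (f (Fin.last n)) := block_polyline_last _
  have hO0 : O 0 = (δ : ℂ) * zS (g 0) := block_polyline_zero _
  have hOn : O n' = (δ : ℂ) * zS (g (Fin.last n')) := block_polyline_last _
  -- CLOSED SIDE.  Points of the closed polyline lie in the `r`-fattening of `N`, hence pull back into the band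
  have hCpt : ∀ s ∈ Icc (0 : ℝ) n, C s ∈ cthickening r N.carrier := fun s hs => by
    obtain ⟨⟨i, hi⟩, -⟩ := block_trace_point f hfadj hδ hs.1 hs.2
    obtain ⟨z, hz, hzi⟩ := block_exists_carrier_dist_le N ha (hfN i).1
    refine mem_cthickening_of_dist_le _ z r _ hz ?_
    calc dist (C s) z ≤ dist (C s) ((δ : ℂ) * zS (f i)) + dist ((δ : ℂ) * zS (f i)) z := dist_triangle _ _ _
      _ ≤ δ + δ := add_le_add hi hzi
      _ ≤ r := by linarith
  have hCband : ∀ s ∈ Icc (0 : ℝ) n,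
      |(Φ.symm (C s)).im| ≤ 1 - 2 * ν ∧ Φ.symm (C s) ∈ Icc (-2 : ℝ) 2 ×ℂ Icc (-2 : ℝ) 2 := fun s hs =>
    block_closed_point hΦ hν0 hν4 hucm hθuc htθ (fun hx => n3 _ (hCpt s hs) hx) (n4 _ (hCpt s hs))
  have h0mem : (0 : ℝ) ∈ Icc (0 : ℝ) n := ⟨le_rfl, Nat.cast_nonneg n⟩
  have hnmem : (n : ℝ) ∈ Icc (0 : ℝ) n := ⟨Nat.cast_nonneg n, le_rfl⟩
  -- the first point: a cap point beyond `arc 1`, pulled back to `re ≥ 1 + η_r/2`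
  have hstart : 1 + ηr / 2 ≤ (Φ.symm (C 0)).re := by
    obtain ⟨z0, hz0, hd0⟩ := block_exists_arc_dist_le N 0 ha hf0
    rw [← hC0] at hd0
    have hcap : ∀ y : ℂ, dist y (C 0) < r / 2 → y ∉ R.carrier := fun y hy =>
      (n5 y (mem_cthickening_of_dist_le y z0 r _ hz0 (by linarith [dist_triangle y (C 0) z0]))).1
    obtain ⟨-, hq1⟩ := n5 (C 0) (mem_cthickening_of_dist_le _ z0 r _ hz0 (by linarith))
    obtain ⟨hband0, hbox0⟩ := hCband 0 h0mem
    obtain ⟨z1, hz1, hd1⟩ := block_near_side hΦ hθuc 1 hq1 htθ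
    obtain ⟨hz1re, -⟩ := SquareModel.mem_arc_one.1 hz1
    obtain ⟨e1, -, -, -⟩ := block_re_im_of_dist hd1.le
    have him0 := abs_le.1 hband0
    exact block_re_ge_of_cap hΦ hηr hηr1 (half_pos hr) hucr hcap hbox0 (by linarith)
      ⟨by linarith [him0.1], by linarith [him0.2]⟩
  -- the last point: a cap point beyond `arc 3`, pulled back to `re ≤ -1 - η_r/2`
  have hend : (Φ.symm (C n)).re ≤ -1 - ηr / 2 := by
    obtain ⟨z0, hz0, hd0⟩ := block_exists_arc_dist_le N 2 ha hfn
    rw [← hCn] at hd0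
    have hcap : ∀ y : ℂ, dist y (C n) < r / 2 → y ∉ R.carrier := fun y hy =>
      (n6 y (mem_cthickening_of_dist_le y z0 r _ hz0 (by linarith [dist_triangle y (C n) z0]))).1
    obtain ⟨-, hq3⟩ := n6 (C n) (mem_cthickening_of_dist_le _ z0 r _ hz0 (by linarith))
    obtain ⟨hbandn, hboxn⟩ := hCband n hnmem
    obtain ⟨z3, hz3, hd3⟩ := block_near_side hΦ hθuc 3 hq3 htθ
    obtain ⟨hz3re, -⟩ := SquareModel.mem_arc_three.1 hz3
    obtain ⟨-, e2, -, -⟩ := block_re_im_of_dist hd3.le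
    have himn := abs_le.1 hbandn
    exact block_re_le_of_cap hΦ hηr hηr1 (half_pos hr) hucr hcap hboxn (by linarith)
      ⟨by linarith [himn.1], by linarith [himn.2]⟩
  -- OPEN SIDE.  Points of the open polyline are within `δ` of a site in `Ω`, hence pull back into the strip
  have hOstrip : ∀ s ∈ Icc (0 : ℝ) n', |(Φ.symm (O s)).re| ≤ 1 + ηr / 4 := fun s hs => by
    obtain ⟨⟨j, hj⟩, -⟩ := block_trace_point g hgadj hδ hs.1 hs.2
    exact (block_near_carrier hΦ hθruc (hgR j).1 (hj.trans_lt (by linarith))).le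
  have hsq : 2 * Real.sqrt 2 * δ ≤ 3 * δ := wide_slack_le_three hδ.le
  have hbot : (Φ.symm (O 0)).im ≤ -(1 - 2 * ν) := by
    have h0 : infDist (O 0) (R.arc 0) ≤ 3 * δ := by rw [hO0]; exact hg0.trans hsq
    obtain ⟨z, hz, hd⟩ := block_near_side hΦ hθuc 0 h0 (by linarith)
    obtain ⟨hzim, -⟩ := SquareModel.mem_arc_zero.1 hz
    obtain ⟨-, -, -, e4⟩ := block_re_im_of_dist hd.le
    linarith
  have htop : 1 - 2 * ν ≤ (Φ.symm (O n')).im := by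
    have h2 : infDist (O n') (R.arc 2) ≤ 3 * δ := by rw [hOn]; exact hgn.trans hsq
    obtain ⟨z, hz, hd⟩ := block_near_side hΦ hθuc 2 h2 (by linarith)
    obtain ⟨hzim, -⟩ := SquareModel.mem_arc_two.1 hz
    obtain ⟨-, -, e3, -⟩ := block_re_im_of_dist hd.le
    linarith
  -- the pulled-back polylines cross the rectangle `[-(1 + η_r/4), 1 + η_r/4] × [-(1 - 2ν), 1 - 2ν]` transversally: they meet
  obtain ⟨s, hs, s', hs', heq⟩ := block_model_crossing (γ₁ := fun s => Φ.symm (C s)) (γ₂ := fun s => Φ.symm (O s))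
    (Φ.symm.continuous.comp (continuous_affineInterp _)) (Φ.symm.continuous.comp (continuous_affineInterp _))
    (Nat.cast_nonneg n) (Nat.cast_nonneg n') (by positivity : (0 : ℝ) ≤ 1 + ηr / 4)
    (by linarith : (0 : ℝ) < 1 - 2 * ν) (fun s hs => (hCband s hs).1) (by linarith [hstart])
    (by linarith [hend]) hOstrip hbot htop
  -- but an open and a closed polyline never meet (planarity of the drawing of `G_s`)
  exact block_traces_disjoint hP f g hfadj hgadj (fun i j hij => (hfN i).2 (hij ▸ (hgR j).2)) hδ hs.1 hs.2
    hs'.1 hs'.2 (Φ.symm.injective heq)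

end Summit.CriticalPhenomena.CardyFormulaZ2.Cruxes.CoveringLeg.FiveArmNull

end
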